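import Summits.QuantumFields.BalabanUV.Beta.FP.PeriodisedFormGaugeLeg
import Summits.QuantumFields.BalabanUV.Beta.FP.PeriodisedLamGaugeLegDoor
import Summits.QuantumFields.BalabanUV.Beta.FP.TorusSymGaugeCovariance
import Summits.QuantumFields.BalabanUV.Beta.FP.TorusCombRows
import Summits.QuantumFields.BalabanUV.Beta.FP.NestedStepLawTorusTransportedRowsGradedSym

/-!
# `BalabanUV.Beta.FP.PeriodisedWardOrderOneCompanion` — road «FP» (binder row D1), ROUTE T, memo (31d) blocker (β) `a1` ∕ R-FP-59 (2)(3):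
# **U21's WARD ROW `a1` FOR THE TOTAL FIRST-ORDER TABLE `𝔎₁ = H₁ + Q₁₀ᵀ·G₁·Q₁₀` (R-FP-59's COMPANION) HOLDS WITH `Y₁ = 0` PER DIRECTION UNDER TWO KKT ROWS**

HONEST DEPENDENCY (page 1, mandatory): continuum YM on T⁴ ⇐ BetaPertH ∧ nine spine estimates (0/9 proved); BetaPertH ⇐ (D1) ∧ (D4) ∧ CAP+tail;
G-an2-4 gates asym, D1 and NE2/3/4.  HONEST FRAMING (cell contract, verbatim): «discharging `BetaPertH` makes Bałaban's UV stability UNCONDITIONAL —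
a real constructive-QFT result; it is NOT the continuum limit and NOT the Clay problem.»  ABSOLUTE RULE (cell charter, verbatim): «No internally-minted
statement may enter as a cited fact. Every hypothesis is either kernel-proved in this package or a verbatim quotation of a PUBLISHED theorem with page
reference. The manuscript(s) under audit are NOT citable for their own disputed steps — they are the thing under adjudication; programme-internal
(2001/route/tribunal) claims are never citable.»

WHY.  U21 DISPLAYS `a1 : H₁·[D₂|D₁] + H₀·W₁ = 𝔔₀ᵀ·Y₁`; R-FP-59 (road «FP» OWNER) adds the top step's fresh Λ-sector as an ORDER-1 companion pair — one-shot side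
`Λ₁ᴺ = Q₁₀ᵀ·G₁·Q₁₀`, the generic door's slot (`NestedStepLawOneShotLetters`: `𝔎₁ = H₁ + Q₁₀ᵀ·G₁·Q₁₀` at `G₀ := 0`).  With this lineage's closed forms of the two halves
(`PeriodisedFormGaugeLeg.torus_a1_wilson`, `PeriodisedLamGaugeLegDoor.torus_a1_lam_Q10`) THIS FILE adds the companion's Ward reading ONE LEVEL UP and closes the row.

WHAT ([folklore] finite sums ∕ matrix bookkeeping BY NAME; no `def`, no `def … : Prop`, nothing cited, 0 sorry): §8b `a1_total_eq_zero` (abstract bookkeeping: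
four closed forms + `Q₁₀·[D₂|D₁] = [D̄|0]` + two KKT rows ⇒ the total row vanishes); §9 `torus_companion_mul_Dbar` — the companion `G₁ = w′ • Σ_ā h̄_ā • (perF M′ (dper M′
(SLam Lc c′ (symHessFFAt ρ_c Lc) ā)))|ff` (the LEVEL-1 Λ-family along a level-1 direction `h̄`; `c′` generic, at the record `lamCoeffK (KInvStep Lc 1) (E2 d Lc 1) Lc`)
against U21's coarse generator columns `D̄` (LEVEL-2-RESIDUAL coarse sites; `Lc ∣ M′`): `(G₁·D̄)_{a,t} = w′κ₀ · N̂_a · (σ_t(a⁻)+σ_t(a⁺))∕2` (`PeriodisedLamGaugeLeg` §3 ONE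
LEVEL UP; the coarse-ROOT readings vanish, `tdelta_root_res_eq_zero`); §10 **`torus_a1_total_of_kkt_rows`** — at U21's `hH₀ hQ₁₀ hD₁ hD₂ hDbar hW₁` VERBATIM (generic
`d`), `hH₁` with GENERIC level-0 multiplier coefficients `c` (record: `lamCoeffOf KInv Lc`, `hc` = `summable_lamCoeffOf_copies`), plus `hG₁`: under (K1)
`c₀ • H₀ *ᵥ h = (w ∕ Lc^{d+1}) • Q₁₀ᵀ *ᵥ Λ₁ʰ` and (K1′) `∀ a, w·Λ₁ʰ_a = w′·(stepScale d Lc 0·#B)·Lc^{d+1}·N̂_a`, **`(H₁ + Q₁₀ᵀ·G₁·Q₁₀)·[D₂|D₁] + H₀·W₁ = 0`**.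
(K1)(K1′) are HYPOTHESES (the nested column's KKT rows — the assembly's ∕ the dictionary's).  Discharges NO row of the door by itself and NO binder of row D1;
0 estimates; 0∕4 row-D1 binders (hW, hR, D1Tel, D1Rep); NOT (J-a) complete, NOT (T-ID), NOT SDF, NOT D1, NEVER «G-an2-4 closed», NOT BetaPertH, NOT continuum,
NOT Clay.  «not in print; our bookkeeping».
Unit `b2b-balaban-beta-d1-formalise-leaf-05` (gen 34; probe J16 f9293042fd07dc13), 2026-08-23; no existing file touched.
-/

noncomputable section

namespace Summit.QuantumFields.BalabanUV.Beta.FP.PeriodisedWardOrderOneCompanion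

open scoped BigOperators Matrix
open Finset Matrix
open Literature.MathematicalPhysics.QuantumFieldTheory.Balaban1983to89
open Literature.MathematicalPhysics.QuantumFieldTheory.Balaban1983to89.Beta
open B4TorusKernel.MultiPeriod (translate translate_apply)
open B6Lemma24Torus (pbox mem_pbox)
open ExpKernelCalculus (MKer)
open AffineAveraging (Site box toSite unitVec)
open OneStepResolventKernel (Fib)
open InterLevelTransport (SLam)
open Summit.QuantumFields.BalabanUV.Beta.SymAveragingHessianCounts (symHessFFAt symLinKerAt)
open Summit.QuantumFields.BalabanUV.Beta.FP.KernelPeriodisationFib (Idx perF perF_apply perZ perZ_apply)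
open Summit.QuantumFields.BalabanUV.Beta.FP.KernelPeriodisationFibLoc (dper)
open Summit.QuantumFields.BalabanUV.Beta.FP.TorusGaugeCovariance (tdelta tdelta_translate tgrad tgrad_inl tdelta_eq_zero_of_root proj_sub_eq_zero_of_zsmul_add)
open Summit.QuantumFields.BalabanUV.Beta.FP.TorusGaugeCovarianceCoarse (tgradBlock coarsePt quo_zsmul_add_toSite')
open Summit.QuantumFields.BalabanUV.Beta.FP.TorusCombRows (Res ne_rootOf_iff_proj_ne)
open Literature.MathematicalPhysics.QuantumFieldTheory.LatticeForm (quo)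
open B5Prop11Plancherel (fine)
open AveragingContoursRooted (ctr ctrOff ctrOff_mem_box)
open Summit.QuantumFields.BalabanUV.Beta.GAN24.FineReadoutCauchyFrame (toSite_mem_range)
open Summit.QuantumFields.BalabanUV.Beta.SymShiftedSpread (bhKStepSh)
open Summit.QuantumFields.BalabanUV.Beta.DshAn1 (Dsh)
open Summit.QuantumFields.BalabanUV.Beta.BorderedHessian (bhKStepAt stepScale)
open StepJetData (wilsonA)
open Summit.QuantumFields.BalabanUV.Beta.FP.TorusSymGaugeCovariance (torus_sym_cov₁ torus_sym_cov₂)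
open Summit.QuantumFields.BalabanUV.Beta.FP.NestedStepLawTorusTransportedRowsGradedSym (perF_bhKStepSh_Dsh_ff_eq_perF_bhKStepAt)
open Summit.QuantumFields.BalabanUV.Beta.FP.NestedStepLawTorusInstance (dvd_fine)
open Summit.QuantumFields.BalabanUV.Beta.FP.PeriodisedLamGaugeLeg (sum_perZ_dper_SLam_symHessFFAt_mul_grad_periodic)
open Summit.QuantumFields.BalabanUV.Beta.FP.PeriodisedLamGaugeLegDoor (torus_a1_lam_Q10)
open Summit.QuantumFields.BalabanUV.Beta.FP.PeriodisedFormGaugeLeg (torus_a1_wilson)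

/-- [folklore] **THE BOOKKEEPING OF `a1` WITH THE COMPANION**: abstract matrices; the four CLOSED FORMS are hypotheses (their torus instances:
`PeriodisedFormGaugeLeg.torus_a1_wilson` = `hWil`, `PeriodisedLamGaugeLegDoor.torus_a1_lam_Q10` = `hLam`, `TorusSymGaugeCovariance.torus_sym_cov₁∕₂` = `hcov`,
§9 = `hcomp`, `hσc` = fine residual sites are not block roots); the two KKT rows of the direction (K1) (K1′) are hypotheses; the TOTAL first-order Ward row vanishes. -/
theorem a1_total_eq_zero {ν μ γ₁ γ₂ : Type*} [Fintype ν] [Fintype μ] [Fintype γ₁] [Fintype γ₂]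
    [DecidableEq ν] [DecidableEq μ]
    (H₀ HW HL : Matrix ν ν ℝ) (Q₁₀ : Matrix μ ν ℝ) (G₁ : Matrix μ μ ℝ) (D₂ : Matrix ν γ₂ ℝ) (D₁ : Matrix ν γ₁ ℝ)
    (W₁ : Matrix ν (γ₂ ⊕ γ₁) ℝ) (Dbar : Matrix μ γ₂ ℝ) (h : ν → ℝ) (Λ N : μ → ℝ)
    (σ : ν → γ₂ ⊕ γ₁ → ℝ) (σc : μ → γ₂ ⊕ γ₁ → ℝ) (c w w' L : ℝ)
    -- J11: the WILSON half + the generator's first jet = the diagonal reading of the linearised-KKT residual `H₀h`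
    (hWil : HW * fromCols D₂ D₁ + H₀ * W₁ = of fun v e => -(c / 2) * ((H₀ *ᵥ h) v * σ v e))
    -- J15c: the Λ half = diagonal reading of `Q₁₀ᵀΛ` minus the coarse-endpoint reading pulled back through `Q₁₀ᵀ`
    (hLam : HL * fromCols D₂ D₁ = of fun v e =>
      w / (2 * L) * ((Q₁₀ᵀ *ᵥ Λ) v * σ v e - (Q₁₀ᵀ *ᵥ fun a => Λ a * σc a e) v))
    -- c0: one-step covariance of the averaging rows against the gauge modes
    (hcov : Q₁₀ * fromCols D₂ D₁ = fromCols Dbar 0)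
    -- the companion's Ward reading ONE LEVEL UP (level-2-residual parameters: only the endpoint reading survives)
    (hcomp : G₁ * Dbar = of fun a t => w' / (2 * L) * (N a * σc a (Sum.inl t)))
    -- fine residual sites are not block roots: no coarse-endpoint reading on the fine residual columns
    (hσc : ∀ a s, σc a (Sum.inr s) = 0)
    -- the two KKT rows of the direction
    (K1 : c • H₀ *ᵥ h = (w / L) • Q₁₀ᵀ *ᵥ Λ) (K1' : w • Λ = w' • N) :
    (HW + HL + Q₁₀ᵀ * G₁ * Q₁₀) * fromCols D₂ D₁ + H₀ * W₁ = 0 := by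
  have e1 : (HW + HL + Q₁₀ᵀ * G₁ * Q₁₀) * fromCols D₂ D₁ + H₀ * W₁
      = (HW * fromCols D₂ D₁ + H₀ * W₁) + HL * fromCols D₂ D₁ + Q₁₀ᵀ * (G₁ * (Q₁₀ * fromCols D₂ D₁)) := by
    simp only [Matrix.add_mul, Matrix.mul_assoc]; abel
  rw [e1, hWil, hLam, hcov, Matrix.mul_fromCols, hcomp, Matrix.mul_zero]
  have k1 : ∀ v, c * (H₀ *ᵥ h) v = w / L * (Q₁₀ᵀ *ᵥ Λ) v := fun v => by
    have := congrFun K1 v; simpa only [Pi.smul_apply, smul_eq_mul] using this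
  have k1' : ∀ a, w * Λ a = w' * N a := fun a => by
    have := congrFun K1' a; simpa only [Pi.smul_apply, smul_eq_mul] using this
  ext v e
  rw [Matrix.add_apply, Matrix.add_apply, Matrix.of_apply, Matrix.of_apply, Matrix.zero_apply, Matrix.mul_apply]
  cases e with
  | inl t =>
      simp only [Matrix.fromCols_apply_inl, Matrix.of_apply, Matrix.transpose_apply]
      have hdiag : -(c / 2) * ((H₀ *ᵥ h) v * σ v (Sum.inl t)) = -(w / (2 * L) * ((Q₁₀ᵀ *ᵥ Λ) v * σ v (Sum.inl t))) := by
        have := k1 v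
        have h2 : -(c / 2) * ((H₀ *ᵥ h) v * σ v (Sum.inl t)) = -(1 / 2) * (c * (H₀ *ᵥ h) v) * σ v (Sum.inl t) := by ring
        rw [h2, this]; ring
      rw [hdiag]
      simp only [Matrix.mulVec, dotProduct, Matrix.transpose_apply]
      have hsum : ∑ a, Q₁₀ a v * (w' / (2 * L) * (N a * σc a (Sum.inl t)))
          = w / (2 * L) * ∑ a, Q₁₀ a v * (Λ a * σc a (Sum.inl t)) := by
        rw [Finset.mul_sum]
        refine Finset.sum_congr rfl fun a _ => ?_
        have := k1' a
        calc Q₁₀ a v * (w' / (2 * L) * (N a * σc a (Sum.inl t)))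
            = Q₁₀ a v * ((w' * N a) * σc a (Sum.inl t)) / (2 * L) := by ring
          _ = Q₁₀ a v * ((w * Λ a) * σc a (Sum.inl t)) / (2 * L) := by rw [this]
          _ = w / (2 * L) * (Q₁₀ a v * (Λ a * σc a (Sum.inl t))) := by ring
      rw [hsum]; ring
  | inr s =>
      simp only [Matrix.fromCols_apply_inr, Matrix.zero_apply, hσc, mul_zero, Finset.sum_const_zero]
      have hdiag : -(c / 2) * ((H₀ *ᵥ h) v * σ v (Sum.inr s)) = -(w / (2 * L) * ((Q₁₀ᵀ *ᵥ Λ) v * σ v (Sum.inr s))) := by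
        have := k1 v
        have h2 : -(c / 2) * ((H₀ *ᵥ h) v * σ v (Sum.inr s)) = -(1 / 2) * (c * (H₀ *ᵥ h) v) * σ v (Sum.inr s) := by ring
        rw [h2, this]; ring
      rw [hdiag]
      simp only [Matrix.mulVec, dotProduct, mul_zero, Finset.sum_const_zero, sub_zero]
      ring

variable {d : ℕ} (M' : Fin (d + 1) → ℕ) [∀ μ, NeZero (M' μ)] (Lc : ℕ) [NeZero Lc]

omit [∀ μ, NeZero (M' μ)] [NeZero Lc] in
/-- [folklore] two readings of a `Sum.elim`-valued column potential add inside the `Sum.elim` (no case split on the index type needed downstream). -/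
theorem sum_elim_apply_add {α β γ : Type*} (F : α → γ → ℝ) (G : β → γ → ℝ) (e : α ⊕ β) (z₁ z₂ : γ) :
    Sum.elim F G e z₁ + Sum.elim F G e z₂ = Sum.elim (fun t => F t z₁ + F t z₂) (fun s => G s z₁ + G s z₂) e := by
  cases e <;> rfl

/-! ### §9 THE COMPANION's WARD READING ONE LEVEL UP: against the LEVEL-2-RESIDUAL coarse gauge parameters `t ∈ Res (ctr (d+1) Lc) Lc M′` the
coarse-endpoint readings of J15c §4 VANISH (a residual site is no block root, `Lc ∣ M′`), and only the endpoint reading of the coarse bond survives. -/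

omit [∀ μ, NeZero (M' μ)] in
/-- [folklore] the periodic indicator of a level-2-RESIDUAL coarse site vanishes at every level-2 root point `Lc•y + ρ_c + Lc•v` (`Lc ∣ M′ i`). -/
theorem tdelta_root_res_eq_zero (hM' : ∀ i, Lc ∣ M' i) (y v : Site (d + 1)) (t : Res (ctr (d + 1) Lc) Lc M') :
    tdelta M' ((Lc : ℤ) • y + toSite (ctrOff (d + 1) Lc) + (Lc : ℤ) • v) t.1 = 0 := by
  have hLc : 0 < Lc := Nat.pos_of_ne_zero (NeZero.ne Lc)
  have hLc1 : 1 ≤ Lc := hLc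
  have ht := (ne_rootOf_iff_proj_ne hLc (toSite_mem_range (ctrOff_mem_box hLc1)) _).1 t.2
  refine tdelta_eq_zero_of_root M' hM' ?_ ht
  have e : (Lc : ℤ) • y + toSite (ctrOff (d + 1) Lc) + (Lc : ℤ) • v = (Lc : ℤ) • (y + v) + toSite (ctrOff (d + 1) Lc) := by
    rw [smul_add]; abel
  rw [e]
  exact proj_sub_eq_zero_of_zsmul_add _ _ _

omit [∀ μ, NeZero (M' μ)] in
/-- [folklore] the same at the root point itself (`v = 0`). -/
theorem tdelta_root_res_eq_zero' (hM' : ∀ i, Lc ∣ M' i) (y : Site (d + 1)) (t : Res (ctr (d + 1) Lc) Lc M') :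
    tdelta M' ((Lc : ℤ) • y + toSite (ctrOff (d + 1) Lc)) t.1 = 0 := by
  have h := tdelta_root_res_eq_zero M' Lc hM' y 0 t
  simpa only [smul_zero, add_zero] using h

/-- **J16-§9 — THE COMPANION's WARD READING** (the level-1 Λ-family `V¹_ā = SLam Lc c′ (symHessFFAt ρ_c Lc) ā` periodised on the coarse torus `M′`, along a
level-1 direction `h̄`, weight `w′` — R-FP-59's `Λ₁ᴳ(h̄)` with the coefficients `c′` GENERIC (at the record `c′ = lamCoeffK (KInvStep Lc 1) (E2 d Lc 1) Lc`) —,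
against U21's coarse generator columns `D̄` (level-2-residual parameters `t`, scale factor `κ₀`; at U21 `κ₀ = stepScale d Lc 0 · #B`):
`(G₁ · D̄)_{a,t} = w′κ₀ · N̂(a) · (σ_t(a⁻) + σ_t(a⁺)) ∕ 2`, `N̂(a) := Σ_ā h̄_ā Σ_μ Σ'_y c′^per_ā(μ,y) · q¹_{(μ,y)}(a)` — the level-2 multiplier jet of `h̄` read back on the
coarse bond `a` through the first-order (0.4) kernel (J15c §4 with `M ↦ M′`, `M′ ↦ M′∕Lc`; the two coarse-ROOT readings vanish by `tdelta_root_res_eq_zero`). -/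
theorem torus_companion_mul_Dbar (hM' : ∀ i, Lc ∣ M' i)
    (c' : Fin (d + 1) → Site (d + 1) → Fin (d + 1) → Site (d + 1) → ℝ)
    (hc' : ∀ κ' u μ y, Summable fun m : Site (d + 1) => c' μ (translate (fun i => M' i / Lc) y m) κ' u)
    (w' κ₀ : ℝ) (hbar : ↥(pbox M') × Fin (d + 1) → ℝ)
    {G₁ : Matrix (↥(pbox M') × Fin (d + 1)) (↥(pbox M') × Fin (d + 1)) ℝ}
    (hG₁ : G₁ = w' • ∑ a : ↥(pbox M') × Fin (d + 1), hbar a •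
        (perF M' (dper M' (SLam Lc c' (fun μ y => symHessFFAt (toSite (ctrOff (d + 1) Lc)) Lc μ y) a.2 (a.1 : Site (d + 1))))).submatrix
          (fun b : ↥(pbox M') × Fin (d + 1) => ((b.1, Sum.inl b.2) : Idx M' (Fib d)))
          (fun b : ↥(pbox M') × Fin (d + 1) => ((b.1, Sum.inl b.2) : Idx M' (Fib d))))
    {Dbar : Matrix (↥(pbox M') × Fin (d + 1)) (Res (ctr (d + 1) Lc) Lc M') ℝ}
    (hDbar : Dbar = Matrix.of fun (a : ↥(pbox M') × Fin (d + 1)) (t : Res (ctr (d + 1) Lc) Lc M') => κ₀ * tgrad M' (a.1, Sum.inl a.2) t.1) :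
    G₁ * Dbar = Matrix.of fun (a : ↥(pbox M') × Fin (d + 1)) (t : Res (ctr (d + 1) Lc) Lc M') =>
      w' * κ₀ * ((∑ ā : ↥(pbox M') × Fin (d + 1), hbar ā *
          ∑ μ : Fin (d + 1), ∑' y : Site (d + 1), (∑' m : Site (d + 1), c' μ (translate (fun i => M' i / Lc) y m) ā.2 (ā.1 : Site (d + 1)))
            * symLinKerAt (toSite (ctrOff (d + 1) Lc)) Lc μ y (a.2, (a.1 : Site (d + 1))))
        * ((tdelta M' (a.1 : Site (d + 1)) t.1 + tdelta M' ((a.1 : Site (d + 1)) + unitVec a.2) t.1) / 2)) := by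
  have hLc1 : 1 ≤ Lc := Nat.one_le_iff_ne_zero.mpr (NeZero.ne Lc)
  have hM'' : ∀ i, M' i = Lc * (M' i / Lc) := fun i => (Nat.mul_div_cancel' (hM' i)).symm
  -- one family member against one residual column
  have hentry : ∀ (ā a : ↥(pbox M') × Fin (d + 1)) (t : Res (ctr (d + 1) Lc) Lc M'),
      ∑ b : ↥(pbox M') × Fin (d + 1),
          perZ M' (dper M' (SLam Lc c' (fun μ y => symHessFFAt (toSite (ctrOff (d + 1) Lc)) Lc μ y) ā.2 (ā.1 : Site (d + 1))))
              (a.1 : Site (d + 1)) (b.1 : Site (d + 1)) (Sum.inl a.2) (Sum.inl b.2)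
            * tgrad M' (b.1, Sum.inl b.2) t.1
        = ∑ μ : Fin (d + 1), ∑' y : Site (d + 1), (∑' m : Site (d + 1), c' μ (translate (fun i => M' i / Lc) y m) ā.2 (ā.1 : Site (d + 1))) *
            ((tdelta M' (a.1 : Site (d + 1)) t.1 + tdelta M' ((a.1 : Site (d + 1)) + unitVec a.2) t.1)
              * symLinKerAt (toSite (ctrOff (d + 1) Lc)) Lc μ y (a.2, (a.1 : Site (d + 1))) / 2) := by
    intro ā a t
    have h := sum_perZ_dper_SLam_symHessFFAt_mul_grad_periodic M' (M' := fun i => M' i / Lc) (L := Lc) (N := Lc) hM'' hLc1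
      (ctrOff_mem_box (d := d + 1) hLc1) c' ā.2 (ā.1 : Site (d + 1)) (hc' ā.2 _) (a.1 : Site (d + 1)) a.2
      (φ := fun z => tdelta M' z t.1) (fun z m => tdelta_translate M' z m t.1)
    rw [Fintype.sum_prod_type]
    simp only [tgrad_inl]
    rw [h]
    refine Finset.sum_congr rfl fun μ _ => tsum_congr fun y => ?_
    rw [tdelta_root_res_eq_zero' M' Lc hM' y t, tdelta_root_res_eq_zero M' Lc hM' y (unitVec μ) t]
    ring
  have hD' : Dbar = κ₀ • Matrix.of fun (a : ↥(pbox M') × Fin (d + 1)) (t : Res (ctr (d + 1) Lc) Lc M') => tgrad M' (a.1, Sum.inl a.2) t.1 := by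
    rw [hDbar]; ext a t; simp only [Matrix.smul_apply, Matrix.of_apply, smul_eq_mul]
  rw [hG₁, hD', Matrix.smul_mul, Matrix.mul_smul, Matrix.sum_mul]
  ext a t
  have hF : ∀ ā : ↥(pbox M') × Fin (d + 1),
      ((perF M' (dper M' (SLam Lc c' (fun μ y => symHessFFAt (toSite (ctrOff (d + 1) Lc)) Lc μ y) ā.2 (ā.1 : Site (d + 1))))).submatrix
            (fun b : ↥(pbox M') × Fin (d + 1) => ((b.1, Sum.inl b.2) : Idx M' (Fib d)))
            (fun b : ↥(pbox M') × Fin (d + 1) => ((b.1, Sum.inl b.2) : Idx M' (Fib d)))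
          * Matrix.of (fun (a : ↥(pbox M') × Fin (d + 1)) (t : Res (ctr (d + 1) Lc) Lc M') => tgrad M' (a.1, Sum.inl a.2) t.1)) a t
        = (∑ μ : Fin (d + 1), ∑' y : Site (d + 1), (∑' m : Site (d + 1), c' μ (translate (fun i => M' i / Lc) y m) ā.2 (ā.1 : Site (d + 1)))
              * symLinKerAt (toSite (ctrOff (d + 1) Lc)) Lc μ y (a.2, (a.1 : Site (d + 1))))
            * ((tdelta M' (a.1 : Site (d + 1)) t.1 + tdelta M' ((a.1 : Site (d + 1)) + unitVec a.2) t.1) / 2) := by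
    intro ā
    rw [Matrix.mul_apply]
    simp only [Matrix.submatrix_apply, perF_apply, Matrix.of_apply]
    rw [hentry ā a t, Finset.sum_mul]
    refine Finset.sum_congr rfl fun μ _ => ?_
    rw [← tsum_mul_right]
    exact tsum_congr fun y => by ring
  simp only [Matrix.smul_apply, Matrix.sum_apply, Matrix.smul_mul, smul_eq_mul, Matrix.of_apply, hF, Finset.mul_sum, Finset.sum_mul]
  exact Finset.sum_congr rfl fun ā _ => Finset.sum_congr rfl fun μ _ => by ring

/-! ### §10 THE PER-DIRECTION THEOREM: `a1` FOR THE TOTAL FIRST-ORDER TABLES (WITH THE COMPANION) HOLDS WITH `Y₁ = 0` UNDER TWO KKT ROWS -/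

set_option synthInstance.maxSize 1024 in
/-- **J16 — U21's ROW `a1` WITH R-FP-59's ORDER-1 COMPANION, PER DIRECTION, `Y₁ = 0`.**  U21's torus objects VERBATIM (generic `d`; the (III′) literal's
`H₀ Q₁₀ D₁ D₂ D̄ W₁`, the first-order form jet `H₁(h)` = `(−2c₀) •` Wilson family `+ w •` Λ-family with the level-0 multiplier coefficients `c` GENERIC
(at the record `lamCoeffOf KInv Lc`), `c₀ := (Lc^{d+1}·stepScale d Lc 0)⁻¹`), PLUS the companion `G₁ = Λ₁ᴳ(h̄)` (the level-1 Λ-family along a level-1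
direction `h̄`, coefficients `c′` GENERIC, weight `w′`).  HYPOTHESES ON THE DIRECTION (displayed, the assembly's ∕ the dictionary's):
(K1) `c₀ • H₀h = (w ∕ Lc^{d+1}) • Q₁₀ᵀ Λ₁ʰ` — `h` is constrained-critical with multiplier jet `Λ₁ʰ_a = Σ_b h_b c^per_b(a)`;
(K1′) `w · Λ₁ʰ_a = w′ · κ₀ · Lc^{d+1} · N̂(a)` on every coarse bond — the one-step multiplier of `h` IS the level-2 multiplier jet of `h̄` read back through the first-order
averaging kernel (`κ₀ = stepScale d Lc 0 · #B`).  CONCLUSION: `(H₁ + Q₁₀ᵀ·G₁·Q₁₀) · [D₂|D₁] + H₀ · W₁ = 0`. -/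
theorem torus_a1_total_of_kkt_rows (hM' : ∀ i, Lc ∣ M' i)
    {H₀ : Matrix (↥(pbox (fine Lc M')) × Fin (d + 1)) (↥(pbox (fine Lc M')) × Fin (d + 1)) ℝ}
    (hH₀ : H₀ = (perF (fine Lc M') (bhKStepSh d Lc (Dsh Lc) 0)).submatrix
        (fun b : ↥(pbox (fine Lc M')) × Fin (d + 1) => ((b.1, Sum.inl b.2) : Idx (fine Lc M') (Fib d)))
        (fun b : ↥(pbox (fine Lc M')) × Fin (d + 1) => ((b.1, Sum.inl b.2) : Idx (fine Lc M') (Fib d))))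
    {Q₁₀ : Matrix (↥(pbox M') × Fin (d + 1)) (↥(pbox (fine Lc M')) × Fin (d + 1)) ℝ}
    (hQ₁₀ : Q₁₀ = (perF (fine Lc M') (bhKStepSh d Lc (Dsh Lc) 0)).submatrix
        (fun a : ↥(pbox M') × Fin (d + 1) => ((coarsePt M' Lc a.1, Sum.inr a.2) : Idx (fine Lc M') (Fib d)))
        (fun b : ↥(pbox (fine Lc M')) × Fin (d + 1) => ((b.1, Sum.inl b.2) : Idx (fine Lc M') (Fib d))))
    {D₁ : Matrix (↥(pbox (fine Lc M')) × Fin (d + 1)) (Res (ctr (d + 1) Lc) Lc (fine Lc M')) ℝ}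
    (hD₁ : D₁ = (tgrad (fine Lc M')).submatrix (fun b : ↥(pbox (fine Lc M')) × Fin (d + 1) => ((b.1, Sum.inl b.2) : Idx (fine Lc M') (Fib d)))
        (Subtype.val : Res (ctr (d + 1) Lc) Lc (fine Lc M') → ↥(pbox (fine Lc M'))))
    {D₂ : Matrix (↥(pbox (fine Lc M')) × Fin (d + 1)) (Res (ctr (d + 1) Lc) Lc M') ℝ}
    (hD₂ : D₂ = (tgradBlock M' Lc).submatrix (fun b : ↥(pbox (fine Lc M')) × Fin (d + 1) => ((b.1, Sum.inl b.2) : Idx (fine Lc M') (Fib d)))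
        (Subtype.val : Res (ctr (d + 1) Lc) Lc M' → ↥(pbox M')))
    {Dbar : Matrix (↥(pbox M') × Fin (d + 1)) (Res (ctr (d + 1) Lc) Lc M') ℝ}
    (hDbar : Dbar = Matrix.of fun (a : ↥(pbox M') × Fin (d + 1)) (t : Res (ctr (d + 1) Lc) Lc M') =>
        stepScale d Lc 0 * (((box (d + 1) Lc).card : ℝ) * tgrad M' (a.1, Sum.inl a.2) t.1))
    (h : ↥(pbox (fine Lc M')) × Fin (d + 1) → ℝ)
    {W₁ : Matrix (↥(pbox (fine Lc M')) × Fin (d + 1)) (Res (ctr (d + 1) Lc) Lc M' ⊕ Res (ctr (d + 1) Lc) Lc (fine Lc M')) ℝ}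
    (hW₁ : W₁ = ∑ b : ↥(pbox (fine Lc M')) × Fin (d + 1), h b •
        Matrix.of (fun (b' : ↥(pbox (fine Lc M')) × Fin (d + 1)) (e : Res (ctr (d + 1) Lc) Lc M' ⊕ Res (ctr (d + 1) Lc) Lc (fine Lc M')) =>
          if b' = b then
            -((((Lc : ℝ) ^ (d + 1) * stepScale d Lc 0)⁻¹)
              * Sum.elim (fun t : Res (ctr (d + 1) Lc) Lc M' => tdelta M' (quo Lc ((b.1 : Site (d + 1)) + unitVec b.2)) t.1)
                  (fun s : Res (ctr (d + 1) Lc) Lc (fine Lc M') => tdelta (fine Lc M') ((b.1 : Site (d + 1)) + unitVec b.2) s.1) e)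
          else 0))
    -- the level-0 multiplier coefficients (GENERIC; at the record `lamCoeffOf KInv Lc`) and the Λ weight `w`
    (c : Fin (d + 1) → Site (d + 1) → Fin (d + 1) → Site (d + 1) → ℝ)
    (hc : ∀ κ' u μ y, Summable fun m : Site (d + 1) => c μ (translate M' y m) κ' u) (w : ℝ)
    {H₁ : Matrix (↥(pbox (fine Lc M')) × Fin (d + 1)) (↥(pbox (fine Lc M')) × Fin (d + 1)) ℝ}
    (hH₁ : H₁ = ((-2 : ℝ) * (((Lc : ℝ) ^ (d + 1) * stepScale d Lc 0)⁻¹)) • (∑ b : ↥(pbox (fine Lc M')) × Fin (d + 1), h b •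
        (perF (fine Lc M') (dper (fine Lc M') (wilsonA d b.2 (b.1 : Site (d + 1))))).submatrix
          (fun b : ↥(pbox (fine Lc M')) × Fin (d + 1) => ((b.1, Sum.inl b.2) : Idx (fine Lc M') (Fib d)))
          (fun b : ↥(pbox (fine Lc M')) × Fin (d + 1) => ((b.1, Sum.inl b.2) : Idx (fine Lc M') (Fib d))))
      + ∑ b : ↥(pbox (fine Lc M')) × Fin (d + 1), h b •
        (w • (perF (fine Lc M') (dper (fine Lc M')
            (SLam Lc c (fun μ y => symHessFFAt (toSite (ctrOff (d + 1) Lc)) Lc μ y) b.2 (b.1 : Site (d + 1))))).submatrix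
          (fun b : ↥(pbox (fine Lc M')) × Fin (d + 1) => ((b.1, Sum.inl b.2) : Idx (fine Lc M') (Fib d)))
          (fun b : ↥(pbox (fine Lc M')) × Fin (d + 1) => ((b.1, Sum.inl b.2) : Idx (fine Lc M') (Fib d)))))
    -- R-FP-59's ORDER-1 COMPANION: the level-1 Λ-family along the level-1 direction `h̄` (coefficients GENERIC; at the record `lamCoeffK (KInvStep Lc 1) (E2 d Lc 1) Lc`)
    (c' : Fin (d + 1) → Site (d + 1) → Fin (d + 1) → Site (d + 1) → ℝ)
    (hc' : ∀ κ' u μ y, Summable fun m : Site (d + 1) => c' μ (translate (fun i => M' i / Lc) y m) κ' u) (w' : ℝ)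
    (hbar : ↥(pbox M') × Fin (d + 1) → ℝ)
    {G₁ : Matrix (↥(pbox M') × Fin (d + 1)) (↥(pbox M') × Fin (d + 1)) ℝ}
    (hG₁ : G₁ = w' • ∑ a : ↥(pbox M') × Fin (d + 1), hbar a •
        (perF M' (dper M' (SLam Lc c' (fun μ y => symHessFFAt (toSite (ctrOff (d + 1) Lc)) Lc μ y) a.2 (a.1 : Site (d + 1))))).submatrix
          (fun b : ↥(pbox M') × Fin (d + 1) => ((b.1, Sum.inl b.2) : Idx M' (Fib d)))
          (fun b : ↥(pbox M') × Fin (d + 1) => ((b.1, Sum.inl b.2) : Idx M' (Fib d))))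
    -- (K1): the direction is constrained-critical with the multiplier jet `Λ₁ʰ`
    (K1 : (((Lc : ℝ) ^ (d + 1) * stepScale d Lc 0)⁻¹) • H₀ *ᵥ h
        = (w / (Lc : ℝ) ^ (d + 1)) • Q₁₀ᵀ *ᵥ (fun a : ↥(pbox M') × Fin (d + 1) =>
            ∑ b : ↥(pbox (fine Lc M')) × Fin (d + 1), h b * ∑' m : Site (d + 1), c a.2 (translate M' (a.1 : Site (d + 1)) m) b.2 (b.1 : Site (d + 1))))
    -- (K1′): the one-step multiplier of `h` is the pulled-back level-2 multiplier jet of `h̄`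
    (K1' : ∀ a : ↥(pbox M') × Fin (d + 1),
        w * (∑ b : ↥(pbox (fine Lc M')) × Fin (d + 1), h b * ∑' m : Site (d + 1), c a.2 (translate M' (a.1 : Site (d + 1)) m) b.2 (b.1 : Site (d + 1)))
          = w' * ((stepScale d Lc 0 * ((box (d + 1) Lc).card : ℝ)) * (Lc : ℝ) ^ (d + 1) *
              ∑ ā : ↥(pbox M') × Fin (d + 1), hbar ā *
                ∑ μ : Fin (d + 1), ∑' y : Site (d + 1), (∑' m : Site (d + 1), c' μ (translate (fun i => M' i / Lc) y m) ā.2 (ā.1 : Site (d + 1)))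
                  * symLinKerAt (toSite (ctrOff (d + 1) Lc)) Lc μ y (a.2, (a.1 : Site (d + 1))))) :
    (H₁ + Q₁₀ᵀ * G₁ * Q₁₀) * Matrix.fromCols D₂ D₁ + H₀ * W₁ = 0 := by
  have hLc1 : 1 ≤ Lc := Nat.one_le_iff_ne_zero.mpr (NeZero.ne Lc)
  have hLc : 0 < Lc := hLc1
  have hL0 : ((Lc : ℝ) ^ (d + 1)) ≠ 0 := pow_ne_zero _ (Nat.cast_ne_zero.2 (NeZero.ne Lc))
  -- names
  set c₀ : ℝ := (((Lc : ℝ) ^ (d + 1) * stepScale d Lc 0)⁻¹) with hc₀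
  set κ₀ : ℝ := stepScale d Lc 0 * ((box (d + 1) Lc).card : ℝ) with hκ₀
  set HW : Matrix (↥(pbox (fine Lc M')) × Fin (d + 1)) (↥(pbox (fine Lc M')) × Fin (d + 1)) ℝ :=
    ((-2 : ℝ) * c₀) • (∑ b : ↥(pbox (fine Lc M')) × Fin (d + 1), h b •
        (perF (fine Lc M') (dper (fine Lc M') (wilsonA d b.2 (b.1 : Site (d + 1))))).submatrix
          (fun b : ↥(pbox (fine Lc M')) × Fin (d + 1) => ((b.1, Sum.inl b.2) : Idx (fine Lc M') (Fib d)))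
          (fun b : ↥(pbox (fine Lc M')) × Fin (d + 1) => ((b.1, Sum.inl b.2) : Idx (fine Lc M') (Fib d)))) with hHW
  set HL : Matrix (↥(pbox (fine Lc M')) × Fin (d + 1)) (↥(pbox (fine Lc M')) × Fin (d + 1)) ℝ :=
    ∑ b : ↥(pbox (fine Lc M')) × Fin (d + 1), h b •
        (w • (perF (fine Lc M') (dper (fine Lc M')
            (SLam Lc c (fun μ y => symHessFFAt (toSite (ctrOff (d + 1) Lc)) Lc μ y) b.2 (b.1 : Site (d + 1))))).submatrix
          (fun b : ↥(pbox (fine Lc M')) × Fin (d + 1) => ((b.1, Sum.inl b.2) : Idx (fine Lc M') (Fib d)))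
          (fun b : ↥(pbox (fine Lc M')) × Fin (d + 1) => ((b.1, Sum.inl b.2) : Idx (fine Lc M') (Fib d)))) with hHL
  have hsplit : H₁ = HW + HL := by rw [hH₁]
  -- the column potentials (J15c's spelling) and the two multiplier jets
  set colPot : (Res (ctr (d + 1) Lc) Lc M' ⊕ Res (ctr (d + 1) Lc) Lc (fine Lc M')) → Site (d + 1) → ℝ :=
    fun e => Sum.elim (fun (t : Res (ctr (d + 1) Lc) Lc M') (z : Site (d + 1)) => tdelta M' (quo Lc z) t.1)
      (fun (s : Res (ctr (d + 1) Lc) Lc (fine Lc M')) (z : Site (d + 1)) => tdelta (fine Lc M') z s.1) e with hcolPot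
  set σ : (↥(pbox (fine Lc M')) × Fin (d + 1)) → (Res (ctr (d + 1) Lc) Lc M' ⊕ Res (ctr (d + 1) Lc) Lc (fine Lc M')) → ℝ :=
    fun v e => colPot e (v.1 : Site (d + 1)) + colPot e ((v.1 : Site (d + 1)) + unitVec v.2) with hσ
  set σc : (↥(pbox M') × Fin (d + 1)) → (Res (ctr (d + 1) Lc) Lc M' ⊕ Res (ctr (d + 1) Lc) Lc (fine Lc M')) → ℝ :=
    fun a e => colPot e ((Lc : ℤ) • (a.1 : Site (d + 1)) + toSite (ctrOff (d + 1) Lc))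
      + colPot e ((Lc : ℤ) • (a.1 : Site (d + 1)) + toSite (ctrOff (d + 1) Lc) + (Lc : ℤ) • unitVec a.2) with hσc
  set Λ : (↥(pbox M') × Fin (d + 1)) → ℝ := fun a =>
    ∑ b : ↥(pbox (fine Lc M')) × Fin (d + 1), h b * ∑' m : Site (d + 1), c a.2 (translate M' (a.1 : Site (d + 1)) m) b.2 (b.1 : Site (d + 1)) with hΛ
  set N : (↥(pbox M') × Fin (d + 1)) → ℝ := fun a => κ₀ * (Lc : ℝ) ^ (d + 1) *
    ∑ ā : ↥(pbox M') × Fin (d + 1), hbar ā *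
      ∑ μ : Fin (d + 1), ∑' y : Site (d + 1), (∑' m : Site (d + 1), c' μ (translate (fun i => M' i / Lc) y m) ā.2 (ā.1 : Site (d + 1)))
        * symLinKerAt (toSite (ctrOff (d + 1) Lc)) Lc μ y (a.2, (a.1 : Site (d + 1))) with hN
  -- (J11) the Wilson half at the (III′) `H₀` (ff block of the shifted spread = ff block of the rooted bordered Hessian)
  have hH₀' : H₀ = (perF (fine Lc M') (bhKStepAt d (toSite (ctrOff (d + 1) Lc)) Lc 0)).submatrix
      (fun b : ↥(pbox (fine Lc M')) × Fin (d + 1) => ((b.1, Sum.inl b.2) : Idx (fine Lc M') (Fib d)))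
      (fun b : ↥(pbox (fine Lc M')) × Fin (d + 1) => ((b.1, Sum.inl b.2) : Idx (fine Lc M') (Fib d))) := by
    rw [hH₀, perF_bhKStepSh_Dsh_ff_eq_perF_bhKStepAt]
  have hWil : HW * Matrix.fromCols D₂ D₁ + H₀ * W₁ = Matrix.of fun v e => -(c₀ / 2) * ((H₀ *ᵥ h) v * σ v e) := by
    have hW₁' := hW₁
    simp only [← neg_mul] at hW₁'
    have hJ := torus_a1_wilson M' Lc (toSite (ctrOff (d + 1) Lc)) Lc
      (Subtype.val : Res (ctr (d + 1) Lc) Lc (fine Lc M') → ↥(pbox (fine Lc M')))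
      (Subtype.val : Res (ctr (d + 1) Lc) Lc M' → ↥(pbox M')) c₀ h hH₀' hD₁ hD₂ hW₁'
    rw [hHW]
    refine hJ.trans ?_
    ext v e
    rw [Matrix.smul_apply, Matrix.of_apply, Matrix.of_apply, smul_eq_mul]
    simp only [hσ, hcolPot]
    rw [sum_elim_apply_add]
    rfl
  -- (J15c) the Λ half in `Q₁₀`
  have hLam : HL * Matrix.fromCols D₂ D₁ = Matrix.of fun v e =>
      w / (2 * (Lc : ℝ) ^ (d + 1)) * ((Q₁₀ᵀ *ᵥ Λ) v * σ v e - (Q₁₀ᵀ *ᵥ fun a => Λ a * σc a e) v) := by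
    have hJ := torus_a1_lam_Q10 M' Lc hQ₁₀
      (Subtype.val : Res (ctr (d + 1) Lc) Lc (fine Lc M') → ↥(pbox (fine Lc M')))
      (Subtype.val : Res (ctr (d + 1) Lc) Lc M' → ↥(pbox M')) w h c hc hD₁ hD₂
    rw [hHL]
    refine hJ.trans ?_
    ext v e
    simp only [Matrix.smul_apply, Matrix.sub_apply, Matrix.of_apply, Matrix.mul_apply, Matrix.transpose_apply, smul_eq_mul, Matrix.mulVec,
      dotProduct, hσ, hσc, hΛ, hcolPot]
    rfl
  -- (c0) the one-step covariance of the averaging rows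
  have hcov : Q₁₀ * Matrix.fromCols D₂ D₁ = Matrix.fromCols Dbar 0 := by
    rw [Matrix.mul_fromCols, hQ₁₀, hD₂, hD₁, hDbar]
    congr 1
    · exact torus_sym_cov₂ M' 0
    · exact torus_sym_cov₁ M' 0
  -- (§9) the companion's reading one level up
  have hDbar' : Dbar = Matrix.of fun (a : ↥(pbox M') × Fin (d + 1)) (t : Res (ctr (d + 1) Lc) Lc M') => κ₀ * tgrad M' (a.1, Sum.inl a.2) t.1 := by
    rw [hDbar]; ext a t; simp only [Matrix.of_apply, hκ₀]; ring
  have hcomp : G₁ * Dbar = Matrix.of fun a t => w' / (2 * (Lc : ℝ) ^ (d + 1)) * (N a * σc a (Sum.inl t)) := by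
    rw [torus_companion_mul_Dbar M' Lc hM' c' hc' w' κ₀ hbar hG₁ hDbar']
    ext a t
    simp only [Matrix.of_apply, hN, hσc, hcolPot, Sum.elim_inl]
    rw [quo_zsmul_add_toSite' (ctrOff_mem_box (d := d + 1) hLc1),
      show (Lc : ℤ) • (a.1 : Site (d + 1)) + toSite (ctrOff (d + 1) Lc) + (Lc : ℤ) • unitVec a.2
          = (Lc : ℤ) • ((a.1 : Site (d + 1)) + unitVec a.2) + toSite (ctrOff (d + 1) Lc) by rw [smul_add]; abel,
      quo_zsmul_add_toSite' (ctrOff_mem_box (d := d + 1) hLc1)]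
    have aux : ∀ S T : ℝ, w' * κ₀ * (S * (T / 2)) = w' / (2 * (Lc : ℝ) ^ (d + 1)) * (κ₀ * (Lc : ℝ) ^ (d + 1) * S * T) := fun S T => by
      field_simp
    exact aux _ _
  -- fine residual sites are not block roots
  have hσc0 : ∀ a s, σc a (Sum.inr s) = 0 := fun a s => by
    simp only [hσc, hcolPot, Sum.elim_inr]
    have hs := (ne_rootOf_iff_proj_ne hLc (toSite_mem_range (ctrOff_mem_box hLc1)) _).1 s.2
    have e1 : (Lc : ℤ) • (a.1 : Site (d + 1)) + toSite (ctrOff (d + 1) Lc) + (Lc : ℤ) • unitVec a.2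
        = (Lc : ℤ) • ((a.1 : Site (d + 1)) + unitVec a.2) + toSite (ctrOff (d + 1) Lc) := by rw [smul_add]; abel
    rw [tdelta_eq_zero_of_root (fine Lc M') (dvd_fine M') (proj_sub_eq_zero_of_zsmul_add _ _ _) hs, e1,
      tdelta_eq_zero_of_root (fine Lc M') (dvd_fine M') (proj_sub_eq_zero_of_zsmul_add _ _ _) hs, add_zero]
  -- (K1′) in vector form
  have K1v : w • Λ = w' • N := by
    funext a
    simp only [Pi.smul_apply, smul_eq_mul]
    exact K1' a
  rw [hsplit]
  exact a1_total_eq_zero H₀ HW HL Q₁₀ G₁ D₂ D₁ W₁ Dbar h Λ N σ σc c₀ w w' ((Lc : ℝ) ^ (d + 1)) hWil hLam hcov hcomp hσc0 K1 K1v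

end Summit.QuantumFields.BalabanUV.Beta.FP.PeriodisedWardOrderOneCompanion

end
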